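import Summits.QuantumFields.BalabanUV.Beta.EriceRemainderEnclosureHistoryAutonomyComparisonAgeCompositionTower10Mid
import Summits.QuantumFields.BalabanUV.Beta.EriceRemainderEnclosureHistoryAutonomyComparisonAgeCompositionYoungPairCapSeparatedAges

/-!
# EriceRemainderEnclosureHistoryAutonomyComparisonAgeCompositionTower10Every — (E109f) route (N), first order: THE RATIO-10 TOWER FOR EVERY YOUNG SECOND AGE, part 2.
# (E109d) `flow_nonneg_census_tower10` closes the census tower `{1, a_1, a_2, …}` (ratios `≥ 10`) for `a_1 ≥ 58` — the first old age must be old enough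
# for the single cap `123∕200` and the pair letters (`j ≥ 56`).  The prequel (E109e) `…Tower10Mid` and this file add the two YOUNG ENDS and the union:
# * **`flow_nonneg_census_tower10_mid`** — `30 ≤ a_1`, `a_2 ≥ 58·a_1`, ratios `≥ 10` above: levels `{1}, {a_1}, {a_2}, …` with `κ_0 := 2∕5` and the SCALED
#   overshoot `κ_1 := (58a_1∕a_2)·G₃(X_2) ≤ 0.143` (closure of `{a_2}` by (E106c) `row₃` at `a′ = 58a_1`, rescaled; closure of `{a_1}` by
#   `x_{a_1} ≤ 77∕125` (`a_1 ≥ 30`, (E94b)) and `3·(77∕125)(1+κ̄₁)+κ̄₁ ≤ (2∕5)(1 − (77∕125)(1+κ̄₁))·30` (`κ̄₁ = 0.143`); young closure `0.7072·(7∕5) ≤ 1`);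
# * **`flow_nonneg_census_tower10_young_pair`** — `2 ≤ a_1 ≤ 29`, `a_2 ≥ 58·a_1`: levels `{1, a_1}, {a_2}, …` with the young-pair cap `0.8333` (E97c) and
#   `κ_0 := (58a_1∕a_2)·G₃(X_2)`: `0.8333·(1 + 0.143) = 0.9897 ≤ 1`;
# * **`flow_nonneg_census_tower10_every`** — EVERY `a_1 ≥ 2` once `a_2 ≥ 58·a_1` and the ratios above are `≥ 10` (the three cases).
# So: the census profile `{1, k₂, k₃, k₄, …}` with ANY number of ages holds at first order for EVERY `k₂ ≥ 2`, `k₃ ≥ 58k₂`, `k_{j+1} ≥ 10k_j` (`j ≥ 3`).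

Cell `pub-balaban`, β-function sub-cell, BINDER row D4 «RemainderConst leaves for Bałaban's split» (`HOME/BINDER-OWNERS.md`; owner lineage `b2b-balaban-beta-an4`;
this file by co-owner #2 lineage `b2b-balaban-beta-d4-p2`, generation 90), β-FLOW TEAM duty (1), FREEZE (0) honoured (def-free; nothing restated).

HONEST FRAMING (page 1, verbatim and binding).  *"Discharging BetaPertH makes Bałaban's UV stability UNCONDITIONAL — a real constructive-QFT result; it is
NOT the continuum limit and NOT the Clay problem."*  THIS FILE DISCHARGES NOTHING OF THE KIND.  Elementary real algebra ∕ real analysis about ABSTRACT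
functionals on a box ]0,γ]^ℕ with displayed floors, profiles and signs, and the FIRST-ORDER renewal objects of route (N) built from them — hypotheses of a
census, not facts; the form, signs, ages and moments of Bałaban's (1.22) limit functional are NOT PRINTED ([I] p. 298; GAPS G-t4-U2-1∕-2) and NOT asserted.
Row D4 class UNCHANGED (critical-path width 0; instance 0∕1; D4 DISCHARGE NO DATE).  HONEST DEPENDENCY: continuum YM on T⁴ ⇐ BetaPertH ∧ nine spine
estimates (0/9 proved); BetaPertH ⇐ (D1) ∧ (D4) ∧ CAP+tail; G-an2-4 gates asym, D1 and NE2/3/4.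

THE POINT (README `HOME/b2b-balaban-beta-d4-p2/g90/README.md` §3).  Uses (E108c) `flow_nonneg_adaptive_cluster_levels_three`, (E94b) `load_le_of_sq`, (E97c)
`young_pair_load_le`, (E109a) `closure_of_bounds_three`, `J₅_le`, `Pf_nonneg`, (E109c) `row_5`, (E109d) `envelope_of_next`, `tower_closure`, `flow_nonneg_census_tower10`
BY NAME.  NOT CLAIMED: `a_2 < 58a_1` for `a_1 < 58`; ratios below 10; anything printed — NOT B12 Thm 2, NOT BetaPertH, NOT continuum, NOT Clay.

WHAT IS PROVED ([folklore]; 0 `def`, 0 sorry).  §2 **`flow_nonneg_census_tower10_young_pair`**.  §3 **`flow_nonneg_census_tower10_every`** (§1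
`flow_nonneg_census_tower10_mid` is the prequel (E109e) `…Tower10Mid`).
-/
noncomputable section
open Finset

namespace Summit.QuantumFields.BalabanUV.Beta.EriceRemainderEnclosureHistoryAutonomyComparisonAgeCompositionTower10Every

open Literature.MathematicalPhysics.QuantumFieldTheory.Balaban1983to89
open Literature.MathematicalPhysics.QuantumFieldTheory.Balaban1983to89.T4BetaStationary
open Literature.MathematicalPhysics.QuantumFieldTheory.Balaban1983to89.T4BetaFlowWellPosed
open Summit.QuantumFields.BalabanUV.Beta.EriceRemainderEnclosureHistoryAutonomyComparisonAgeCompositionYoungPairMoment (load_le_of_sq)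
open Summit.QuantumFields.BalabanUV.Beta.EriceRemainderEnclosureHistoryAutonomyComparisonAgeCompositionAdaptiveLevelsThree (flow_nonneg_adaptive_cluster_levels_three)
open Summit.QuantumFields.BalabanUV.Beta.EriceRemainderEnclosureHistoryAutonomyComparisonAgeCompositionYoungPairCapSeparatedAges (young_pair_load_le)
open Summit.QuantumFields.BalabanUV.Beta.EriceRemainderEnclosureHistoryAutonomyComparisonAgeCompositionTower10Table
open Summit.QuantumFields.BalabanUV.Beta.EriceRemainderEnclosureHistoryAutonomyComparisonAgeCompositionTower10EnvelopeA (lemmaA_1 lemmaA_2 lemmaA_3)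
open Summit.QuantumFields.BalabanUV.Beta.EriceRemainderEnclosureHistoryAutonomyComparisonAgeCompositionTower10EnvelopeB (lemmaA_4 lemmaA_5)
open Summit.QuantumFields.BalabanUV.Beta.EriceRemainderEnclosureHistoryAutonomyComparisonAgeCompositionTower10RowsA (row_1 row_2 row_3)
open Summit.QuantumFields.BalabanUV.Beta.EriceRemainderEnclosureHistoryAutonomyComparisonAgeCompositionTower10RowsB (row_4 row_5)
open Summit.QuantumFields.BalabanUV.Beta.EriceRemainderEnclosureHistoryAutonomyComparisonAgeCompositionTower10 (envelope_of_next tower_closure flow_nonneg_census_tower10)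
open Summit.QuantumFields.BalabanUV.Beta.EriceRemainderEnclosureHistoryAutonomyComparisonAgeCompositionTower10Mid (flow_nonneg_census_tower10_mid)

variable {B : (ℕ → ℝ) → ℝ} {γ b gIR : ℝ} {L : ℕ → ℝ} {K : ℕ} {h g : ℕ → ℝ}

/-! ## §2 The young-pair end: `2 ≤ a_1 ≤ 29`, `a_2 ≥ 58a_1` -/

/-- **THE RATIO-10 TOWER ABOVE THE YOUNG PAIR.**  Ages `a_0 = 1 < a_1 < a_2 < …` (`r ≥ 2`) with `2 ≤ a_1 ≤ 29`, `58a_1 ≤ a_2`, `10a_j ≤ a_{j+1}` (`j ≥ 2`),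
all `< K`, the profile vanishing off them: `0 ≤ ε ≤ e` at every pin — levels `{1,a_1}, {a_2}, {a_3}, …`. [folklore] -/
theorem flow_nonneg_census_tower10_young_pair
    (hmono : ∀ u v : ℕ → ℝ, SeqBox γ u → SeqBox γ v → (∀ j, u j ≤ v j) → B u ≤ B v)
    (hL : ∀ k, 0 ≤ L k) (hb : 0 < b) (hlo : ∀ u, SeqBox γ u → b ≤ B u) (hdom : ∀ u, SeqBox γ u → ∑ k ∈ range K, L k * u k ≤ B u)
    (hh : SeqBox γ h) (hf : MemFlow B gIR h) (hg : ∀ t, 0 < g t ∧ g t ≤ 1)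
    (hgF : ∀ t, 1 ≤ g t * (1 + ∑ k ∈ range K, L k * h (t + k) ^ 3 / 2))
    {r : ℕ} {a : ℕ → ℕ} (hr : 2 ≤ r) (ha0 : a 0 = 1) (ha1 : 2 ≤ a 1) (ha29 : a 1 ≤ 29) (ha2 : 2 < r → 58 * a 1 ≤ a 2)
    (haR : ∀ j, 2 ≤ j → j + 1 < r → 10 * a j ≤ a (j + 1)) (haK : ∀ j, j < r → a j < K)
    (hLa : ∀ l, l < K → (∀ j, j < r → l ≠ a j) → L l = 0)
    {N : ℕ} {KL : ℕ → ℕ → ℕ → ℝ}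
    (hKL : ∀ k n l, KL k n l = if 0 < k ∧ k < K ∧ l < k then L k * h (n + k) ^ 3 / 2 * ∏ t ∈ Ico (n + 1 + l) (n + k + 1), g t else 0)
    {KA : ℕ → ℕ → ℕ → ℝ} {RA : ℕ → (ℕ → ℝ) → ℕ → ℝ}
    (hRA : ∀ i v m, RA i v m = ∑ l ∈ range K, KA i m l * v (m + 1 + l))
    (hKA : ∀ i m l, KA i m l = KL i m l + KA (i + 1) m l) (hKAtop : ∀ m l, KA K m l = 0)
    {e ε : ℕ → ℝ} (he0 : ∀ m, 0 ≤ e m) (hea : ∀ m, e (m + 1) ≤ e m)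
    (hεt : ∀ m, N < m → ε m = 0) (hεrec : ∀ m, ε m = e m - RA 1 ε m) : ∀ m, 0 ≤ ε m ∧ ε m ≤ e m := by
  have hpos : ∀ n, 0 < h n := fun n => (hh n).1
  have hK : 1 ≤ K := by have := haK 0 (by omega); omega
  have h58 : ∀ j, 2 ≤ j → j < r → 58 ≤ a j := by
    intro j hj hjr
    induction j with
    | zero => omega
    | succ i ih =>
      rcases Nat.lt_or_ge i 2 with hi2 | hi2
      · have hi1 : i = 1 := by omega
        subst hi1; show 58 ≤ a 2; have := ha2 (by omega); omega
      · have := ih hi2 (by omega); have := haR i hi2 (by omega); omega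
  have hlt : ∀ j, j + 1 < r → a j < a (j + 1) := by
    intro j hjr
    rcases Nat.lt_or_ge j 2 with hj2 | hj2
    · interval_cases j
      · show a 0 < a 1; rw [ha0]; omega
      · show a 1 < a 2; have := ha2 (by omega); omega
    · have := haR j hj2 hjr; have := h58 j hj2 (by omega); omega
  have hsm : ∀ i j, i < j → j < r → a i < a j := by
    intro i j hij hjr
    induction j with
    | zero => omega
    | succ j ih =>
      rcases Nat.lt_or_ge i j with hij' | hij'
      · exact lt_trans (ih hij' (by omega)) (hlt j hjr)
      · have : i = j := by omega
        subst this; exact hlt i hjr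
  have ha1' : ∀ j, j < r → 1 ≤ a j := by
    intro j hjr
    rcases Nat.lt_or_ge j 2 with hj2 | hj2
    · interval_cases j <;> omega
    · have := h58 j hj2 hjr; omega
  -- loads and caps
  obtain ⟨X, hX⟩ : ∃ X : ℕ → ℕ → ℝ, ∀ j q, X j q = (a j : ℝ) * (L (a j) * h (q + a j) ^ 3 / 2) := ⟨_, fun _ _ => rfl⟩
  have hX0 : ∀ j q, 0 ≤ X j q := fun j q => by rw [hX]; have := hL (a j); have := hpos (q + a j); positivity
  obtain ⟨XP, hXP⟩ : ∃ XP : ℕ → ℝ, ∀ q, XP q = L 1 * h (q + 1) ^ 3 / 2 + (a 1 : ℝ) * (L (a 1) * h (q + a 1) ^ 3 / 2) := ⟨_, fun _ => rfl⟩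
  have hXP0 : ∀ q, 0 ≤ XP q := fun q => by
    rw [hXP]; have := hL 1; have := hL (a 1); have := hpos (q + 1); have := hpos (q + a 1); positivity
  have hXPc : ∀ q, XP q ≤ 8333 / 10000 := fun q => by
    rw [hXP]; exact young_pair_load_le hmono hL hb hlo hdom hh hf ha1 ha29 (haK 1 (by omega)) q
  have hXc : ∀ j q, 2 ≤ j → j < r → X j q ≤ 123 / 200 := fun j q hj hjr => by
    rw [hX]
    have h58j : (58 : ℝ) ≤ a j := by exact_mod_cast h58 j hj hjr
    exact load_le_of_sq hmono hL hb hlo hdom hh hf (ha1' j hjr) (haK j hjr) (so := 123 / 200) (by norm_num) (by nlinarith [h58j]) q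
  -- THE TABLE (E106b) and the overshoots of the levels {1,a_1}, {a_2}, {a_3}, … (indexed j = 0, 1, 2, …)
  obtain ⟨J₁, hJ₁⟩ : ∃ J₁ : ℝ → ℝ, ∀ x, J₁ x = if x ≤ 3 / 10 then if x ≤ 4 / 25 then if x ≤ 17 / 200 then if x ≤ 3 / 50 then if x ≤ 1 / 25 then if x ≤ 1 / 50 then 97 / 1000 else 113 / 1000 else 13 / 100 else if x ≤ 2 / 25 then 37 / 250 else 153 / 1000 else if x ≤ 3 / 25 then if x ≤ 1 / 10 then 21 / 125 else 93 / 500 else if x ≤ 7 / 50 then 39 / 200 else 41 / 200 else if x ≤ 11 / 50 then if x ≤ 37 / 200 then if x ≤ 9 / 50 then 27 / 125 else 21 / 100 else if x ≤ 1 / 5 then 227 / 1000 else 6 / 25 else if x ≤ 13 / 50 then if x ≤ 6 / 25 then 127 / 500 else 67 / 250 else if x ≤ 7 / 25 then 283 / 1000 else 299 / 1000 else if x ≤ 23 / 50 then if x ≤ 19 / 50 then if x ≤ 17 / 50 then if x ≤ 8 / 25 then 317 / 1000 else 67 / 200 else if x ≤ 9 / 25 then 89 / 250 else 377 / 1000 else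 if x ≤ 21 / 50 then if x ≤ 2 / 5 then 401 / 1000 else 213 / 500 else if x ≤ 11 / 25 then 227 / 500 else 97 / 200 else if x ≤ 27 / 50 then if x ≤ 1 / 2 then if x ≤ 12 / 25 then 259 / 500 else 553 / 1000 else if x ≤ 13 / 25 then 74 / 125 else 637 / 1000 else if x ≤ 29 / 50 then if x ≤ 14 / 25 then 343 / 500 else 371 / 500 else if x ≤ 3 / 5 then 161 / 200 else 33 / 40 := ⟨_, fun _ => rfl⟩
  obtain ⟨J₂, hJ₂⟩ : ∃ J₂ : ℝ → ℝ, ∀ x, J₂ x = if x ≤ 3 / 10 then if x ≤ 4 / 25 then if x ≤ 17 / 200 then if x ≤ 3 / 50 then if x ≤ 1 / 25 then if x ≤ 1 / 50 then 81 / 1000 else 47 / 500 else 27 / 250 else if x ≤ 2 / 25 then 31 / 250 else 16 / 125 else if x ≤ 3 / 25 then if x ≤ 1 / 10 then 7 / 50 else 31 / 200 else if x ≤ 7 / 50 then 163 / 1000 else 171 / 1000 else if x ≤ 11 / 50 then if x ≤ 37 / 200 then if x ≤ 9 / 50 then 9 / 50 else 7 / 40 else if x ≤ 1 / 5 then 19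 / 100 else 1 / 5 else if x ≤ 13 / 50 then if x ≤ 6 / 25 then 53 / 250 else 28 / 125 else if x ≤ 7 / 25 then 59 / 250 else 249 / 1000 else if x ≤ 23 / 50 then if x ≤ 19 / 50 then if x ≤ 17 / 50 then if x ≤ 8 / 25 then 33 / 125 else 7 / 25 else if x ≤ 9 / 25 then 297 / 1000 else 63 / 200 else if x ≤ 21 / 50 then if x ≤ 2 / 5 then 67 / 200 else 71 / 200 else if x ≤ 11 / 25 then 379 / 1000 else 101 / 250 else if x ≤ 27 / 50 then if x ≤ 1 / 2 then if x ≤ 12 / 25 then 54 / 125 else 461 / 1000 else if x ≤ 13 / 25 then 493 / 1000 else 531 / 1000 else if x ≤ 29 / 50 then if x ≤ 14 / 25 then 143 / 250 else 309 / 500 else if x ≤ 3 / 5 then 671 / 1000 else 86 / 125 := ⟨_, fun _ => rfl⟩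
  obtain ⟨J₃, hJ₃⟩ : ∃ J₃ : ℝ → ℝ, ∀ x, J₃ x = if x ≤ 3 / 10 then if x ≤ 4 / 25 then if x ≤ 17 / 200 then if x ≤ 3 / 50 then if x ≤ 1 / 25 then if x ≤ 1 / 50 then 61 / 1000 else 71 / 1000 else 81 / 1000 else if x ≤ 2 / 25 then 93 / 1000 else 12 / 125 else if x ≤ 3 / 25 then if x ≤ 1 / 10 then 21 / 200 else 117 / 1000 else if x ≤ 7 / 50 then 61 / 500 else 16 / 125 else if x ≤ 11 / 50 then if x ≤ 37 / 200 then if x ≤ 9 / 50 then 27 / 200 else 131 / 1000 else if x ≤ 1 / 5 then 71 / 500 else 3 / 20 else if x ≤ 13 / 50 then if x ≤ 6 / 25 then 159 / 1000 else 21 / 125 else if x ≤ 7 / 25 then 177 / 1000 else 187 / 1000 else if x ≤ 23 / 50 then if x ≤ 19 / 50 then if x ≤ 17 / 50 then if x ≤ 8 / 25 then 99 / 500 else 21 / 100 else if x ≤ 9 / 25 then 223 / 1000 else 59 / 250 else if x ≤ 21 / 50 then if x ≤ 2 / 5 then 251 / 1000 else 267 / 1000 else if x ≤ 11 / 25 then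 71 / 250 else 303 / 1000 else if x ≤ 27 / 50 then if x ≤ 1 / 2 then if x ≤ 12 / 25 then 81 / 250 else 173 / 500 else if x ≤ 13 / 25 then 37 / 100 else 199 / 500 else if x ≤ 29 / 50 then if x ≤ 14 / 25 then 429 / 1000 else 58 / 125 else if x ≤ 3 / 5 then 503 / 1000 else 129 / 250 := ⟨_, fun _ => rfl⟩
  obtain ⟨J₄, hJ₄⟩ : ∃ J₄ : ℝ → ℝ, ∀ x, J₄ x = if x ≤ 3 / 10 then if x ≤ 4 / 25 then if x ≤ 17 / 200 then if x ≤ 3 / 50 then if x ≤ 1 / 25 then if x ≤ 1 / 50 then 31 / 1000 else 9 / 250 else 41 / 1000 else if x ≤ 2 / 25 then 47 / 1000 else 6 / 125 else if x ≤ 3 / 25 then if x ≤ 1 / 10 then 53 / 1000 else 59 / 1000 else if x ≤ 7 / 50 then 61 / 1000 else 8 / 125 else if x ≤ 11 / 50 then if x ≤ 37 / 200 then if x ≤ 9 / 50 then 17 / 250 else 33 / 500 else if x ≤ 1 / 5 then 71 / 1000 else 3 / 40 else if x ≤ 13 / 50 then if x ≤ 6 / 25 then 2 / 25 else 21 / 250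 else if x ≤ 7 / 25 then 89 / 1000 else 47 / 500 else if x ≤ 23 / 50 then if x ≤ 19 / 50 then if x ≤ 17 / 50 then if x ≤ 8 / 25 then 99 / 1000 else 21 / 200 else if x ≤ 9 / 25 then 14 / 125 else 59 / 500 else if x ≤ 21 / 50 then if x ≤ 2 / 5 then 63 / 500 else 67 / 500 else if x ≤ 11 / 25 then 71 / 500 else 19 / 125 else if x ≤ 27 / 50 then if x ≤ 1 / 2 then if x ≤ 12 / 25 then 81 / 500 else 173 / 1000 else if x ≤ 13 / 25 then 37 / 200 else 199 / 1000 else if x ≤ 29 / 50 then if x ≤ 14 / 25 then 43 / 200 else 29 / 125 else if x ≤ 3 / 5 then 63 / 250 else 129 / 500 := ⟨_, fun _ => rfl⟩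
  obtain ⟨J₅, hJ₅⟩ : ∃ J₅ : ℝ → ℝ, ∀ x, J₅ x = if x ≤ 3 / 10 then if x ≤ 4 / 25 then if x ≤ 17 / 200 then if x ≤ 3 / 50 then if x ≤ 1 / 25 then if x ≤ 1 / 50 then 17 / 1000 else 1 / 50 else 23 / 1000 else if x ≤ 2 / 25 then 13 / 500 else 27 / 1000 else if x ≤ 3 / 25 then if x ≤ 1 / 10 then 29 / 1000 else 33 / 1000 else if x ≤ 7 / 50 then 17 / 500 else 9 / 250 else if x ≤ 11 / 50 then if x ≤ 37 / 200 then if x ≤ 9 / 50 then 19 / 500 else 37 / 1000 else if x ≤ 1 / 5 then 1 / 25 else 21 / 500 else if x ≤ 13 / 50 then if x ≤ 6 / 25 then 11 / 250 else 47 / 1000 else if x ≤ 7 / 25 then 49 / 1000 else 13 / 250 else if x ≤ 23 / 50 then if x ≤ 19 / 50 then if x ≤ 17 / 50 then if x ≤ 8 / 25 then 11 / 200 else 29 / 500 else if x ≤ 9 / 25 then 31 / 500 else 13 / 200 else if x ≤ 21 / 50 then if x ≤ 2 / 5 then 7 / 100 else 37 / 500 else if x ≤ 11 / 25 then 79 /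 1000 else 21 / 250 else if x ≤ 27 / 50 then if x ≤ 1 / 2 then if x ≤ 12 / 25 then 9 / 100 else 12 / 125 else if x ≤ 13 / 25 then 51 / 500 else 11 / 100 else if x ≤ 29 / 50 then if x ≤ 14 / 25 then 119 / 1000 else 16 / 125 else if x ≤ 3 / 5 then 139 / 1000 else 143 / 1000 := ⟨_, fun _ => rfl⟩
  obtain ⟨Pf, hN⟩ : ∃ Pf : ℝ → ℝ, ∀ x, Pf x = if x < 9 / 25 then if x < 11 / 50 then if x < 4 / 25 then if x < 3 / 25 then if x < 1 / 10 then 33 / 40 else 161 / 200 else if x < 7 / 50 then 371 / 500 else 343 / 500 else if x < 1 / 5 then if x < 9 / 50 then 637 / 1000 else 74 / 125 else 553 / 1000 else if x < 3 / 10 then if x < 13 / 50 then if x < 6 / 25 then 259 / 500 else 97 / 200 else if x < 7 / 25 then 227 / 500 else 213 / 500 else if x < 17 / 50 then if x < 8 / 25 then 401 / 1000 else 377 / 1000 else 89 / 250 else if x < 1 / 2 then if x < 11 / 25 then if x < 2 / 5 then if x < 19 / 50 then 67 / 200 else 317 / 1000 else if x < 21 / 50 then 299 / 1000 else 283 / 1000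 else if x < 12 / 25 then if x < 23 / 50 then 67 / 250 else 127 / 500 else 6 / 25 else if x < 14 / 25 then if x < 27 / 50 then if x < 13 / 25 then 227 / 1000 else 27 / 125 else 41 / 200 else if x < 3 / 5 then if x < 29 / 50 then 39 / 200 else 93 / 500 else 21 / 125 := ⟨_, fun _ => rfl⟩
  obtain ⟨T, hT⟩ : ∃ T : ℕ → ℕ → ℝ → ℝ, ∀ lo hi x, T lo hi x = if 58 * lo ≤ hi then J₅ x else if 32 * lo < hi then J₄ x else if 16 * lo < hi then J₃ x else if 12 * lo < hi then J₂ x else J₁ x :=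
    ⟨_, fun _ _ _ => rfl⟩
  have hT0 : ∀ lo hi x, 0 ≤ T lo hi x := fun lo hi x => by
    rw [hT]; split_ifs
    exacts [J₅_nonneg hJ₅ x, J₄_nonneg hJ₄ x, J₃_nonneg hJ₃ x, J₂_nonneg hJ₂ x, J₁_nonneg hJ₁ x]
  have hA1 : ∀ {x y : ℝ}, x + y ≤ 7 / 10 → J₁ y ≤ Pf x := fun hxy => lemmaA_1 hJ₁ hN hxy
  have hA2 : ∀ {x y : ℝ}, x + y ≤ 143 / 200 → J₂ y ≤ Pf x := fun hxy => lemmaA_2 hJ₂ hN hxy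
  have hA3 : ∀ {x y : ℝ}, x + y ≤ 151 / 200 → J₃ y ≤ Pf x := fun hxy => lemmaA_3 hJ₃ hN hxy
  have hA4 : ∀ {x y : ℝ}, x + y ≤ 4 / 5 → J₄ y ≤ Pf x := fun hxy => lemmaA_4 hJ₄ hN hxy
  have hA5 : ∀ x y : ℝ, J₅ y ≤ Pf x := lemmaA_5 hJ₅ hN
  have hR1 : ∀ {x κ a a' : ℝ}, 0 ≤ a → 0 ≤ a' → 10 * a ≤ a' → 0 ≤ x → x ≤ 123 / 200 → 0 ≤ κ → κ ≤ Pf x →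
      x * (1 + κ) < 1 ∧ a * (3 * x * (1 + κ) + κ) ≤ J₁ x * (1 - x * (1 + κ)) * a' :=
    fun ha ha' hR hx0 hx1 hk0 hk => row_1 hJ₁ hN ha ha' hR hx0 hx1 hk0 hk
  have hR2 : ∀ {x κ a a' : ℝ}, 0 ≤ a → 0 ≤ a' → 12 * a ≤ a' → 0 ≤ x → x ≤ 123 / 200 → 0 ≤ κ → κ ≤ Pf x →
      x * (1 + κ) < 1 ∧ a * (3 * x * (1 + κ) + κ) ≤ J₂ x * (1 - x * (1 + κ)) * a' :=
    fun ha ha' hR hx0 hx1 hk0 hk => row_2 hJ₂ hN ha ha' hR hx0 hx1 hk0 hk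
  have hR3 : ∀ {x κ a a' : ℝ}, 0 ≤ a → 0 ≤ a' → 16 * a ≤ a' → 0 ≤ x → x ≤ 123 / 200 → 0 ≤ κ → κ ≤ Pf x →
      x * (1 + κ) < 1 ∧ a * (3 * x * (1 + κ) + κ) ≤ J₃ x * (1 - x * (1 + κ)) * a' :=
    fun ha ha' hR hx0 hx1 hk0 hk => row_3 hJ₃ hN ha ha' hR hx0 hx1 hk0 hk
  have hR4 : ∀ {x κ a a' : ℝ}, 0 ≤ a → 0 ≤ a' → 32 * a ≤ a' → 0 ≤ x → x ≤ 123 / 200 → 0 ≤ κ → κ ≤ Pf x →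
      x * (1 + κ) < 1 ∧ a * (3 * x * (1 + κ) + κ) ≤ J₄ x * (1 - x * (1 + κ)) * a' :=
    fun ha ha' hR hx0 hx1 hk0 hk => row_4 hJ₄ hN ha ha' hR hx0 hx1 hk0 hk
  have hR5 : ∀ {x κ a a' : ℝ}, 0 ≤ a → 0 ≤ a' → 58 * a ≤ a' → 0 ≤ x → x ≤ 123 / 200 → 0 ≤ κ → κ ≤ Pf x →
      x * (1 + κ) < 1 ∧ a * (3 * x * (1 + κ) + κ) ≤ J₅ x * (1 - x * (1 + κ)) * a' :=
    fun ha ha' hR hx0 hx1 hk0 hk => row_5 hJ₅ hN ha ha' hR hx0 hx1 hk0 hk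
  obtain ⟨κ, hκ⟩ : ∃ κ : ℕ → ℕ → ℝ, ∀ j q, κ j q = if j = 0 then (if 2 < r then 58 * (a 1 : ℝ) / (a 2 : ℝ) * J₅ (X 2 q) else 0)
      else (if j + 2 < r then T (a (j + 1)) (a (j + 2)) (X (j + 2) q) else 0) := ⟨_, fun _ _ => rfl⟩
  have hκ0b : ∀ q, 0 ≤ κ 0 q ∧ κ 0 q ≤ 143 / 1000 := by
    intro q
    rw [hκ, if_pos rfl]
    split_ifs with h2r
    · have ha1p : (0 : ℝ) < a 1 := by exact_mod_cast ha1' 1 (by omega)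
      have ha2p : (0 : ℝ) < a 2 := by exact_mod_cast ha1' 2 h2r
      have h72 : 58 * (a 1 : ℝ) ≤ a 2 := by exact_mod_cast ha2 h2r
      have hG := J₅_le hJ₅ (X 2 q)
      have hG0 := J₅_nonneg hJ₅ (X 2 q)
      have hq : 58 * (a 1 : ℝ) / (a 2 : ℝ) ≤ 1 := by rw [div_le_iff₀ ha2p]; linarith
      have hq0 : 0 ≤ 58 * (a 1 : ℝ) / (a 2 : ℝ) := by positivity
      constructor
      · positivity
      · calc 58 * (a 1 : ℝ) / (a 2 : ℝ) * J₅ (X 2 q) ≤ 1 * (143 / 1000) := mul_le_mul hq hG hG0 (by norm_num)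
          _ = 143 / 1000 := by norm_num
    · exact ⟨le_rfl, by norm_num⟩
  have hκ0 : ∀ j q, 0 ≤ κ j q := by
    intro j q
    rcases Nat.eq_zero_or_pos j with hj0 | hj0
    · subst hj0; exact (hκ0b q).1
    · rw [hκ, if_neg (by omega)]
      split_ifs
      exacts [hT0 _ _ _, le_rfl]
  -- LEMMA A for the tower levels j ≥ 1 (ages a_(j+1) ≥ 58)
  have hA : ∀ j q, 1 ≤ j → j + 1 < r → κ j q ≤ Pf (X (j + 1) q) := by
    intro j q hj hjr
    rw [hκ, if_neg (by omega)]
    split_ifs with hj2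
    · rw [hT, hX, hX]
      exact envelope_of_next hmono hL hb hlo hdom hh hf hA1 hA2 hA3 hA4 hA5 (le_trans (by norm_num) (h58 (j + 1) (by omega) hjr))
        (haR (j + 1) (by omega) hj2) (haK (j + 2) hj2) q
    · rw [hX]; exact Pf_nonneg hN _
  -- THE ENGINE (E101b) with r − 1 levels: the young pair, then singletons
  obtain ⟨S, hS⟩ : ∃ S : ℕ → Finset ℕ, ∀ j, S j = if j = 0 then {1, a 1} else {a (j + 1)} := ⟨_, fun _ => rfl⟩
  obtain ⟨lo, hlo'⟩ : ∃ lo : ℕ → ℕ, ∀ j, lo j = if j = 0 then 1 else a (j + 1) := ⟨_, fun _ => rfl⟩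
  have hS0 : S 0 = {1, a 1} := by rw [hS, if_pos rfl]
  have hSj : ∀ j, 1 ≤ j → S j = {a (j + 1)} := fun j hj => by rw [hS, if_neg (by omega)]
  have h1ne : (1 : ℕ) ≠ a 1 := by omega
  have hsum0 : ∀ q, ∑ k ∈ S 0, (k : ℝ) * (L k * h (q + k) ^ 3 / 2) = XP q := fun q => by
    rw [hS0, sum_pair h1ne, hXP]; push_cast; ring
  have hsumj : ∀ j q, 1 ≤ j → ∑ k ∈ S j, (k : ℝ) * (L k * h (q + k) ^ 3 / 2) = X (j + 1) q := fun j q hj => by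
    rw [hSj j hj, sum_singleton, hX]
  refine flow_nonneg_adaptive_cluster_levels_three hmono hL hb hlo hdom hh hf hg hgF hK (r := r - 1) (S := S) (lo := lo) (hi := fun j => a (j + 1))
    (κ := κ) hκ0 (fun j hj k hk => ?_) (fun j hj k hk => ?_) (fun j hj k hk => ?_) (fun j hj1 _ => ?_) (fun j hj1 hj => ?_)
    (fun j hj => ?_) (fun i j hij hjr => ?_) (fun l hl hnot => ?_) (fun q => ?_) (fun j q hj1 hjr => ?_)
    hKL hRA hKA hKAtop he0 hea hεt hεrec
  · -- members are ages in [1, K)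
    rcases Nat.eq_zero_or_pos j with hj0 | hj0
    · subst hj0; rw [hS0, mem_insert, mem_singleton] at hk
      rcases hk with hk | hk <;> subst hk
      · exact ⟨le_rfl, by have := haK 0 (by omega); rwa [ha0] at this⟩
      · exact ⟨ha1' 1 (by omega), haK 1 (by omega)⟩
    · rw [hSj j hj0, mem_singleton] at hk; subst hk; exact ⟨ha1' (j + 1) (by omega), haK (j + 1) (by omega)⟩
  · -- lo j ≤ members
    rcases Nat.eq_zero_or_pos j with hj0 | hj0
    · subst hj0; rw [hlo', if_pos rfl]; rw [hS0, mem_insert, mem_singleton] at hk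
      rcases hk with hk | hk <;> subst hk
      exacts [le_rfl, ha1' 1 (by omega)]
    · rw [hSj j hj0, mem_singleton] at hk; subst hk; rw [hlo', if_neg (by omega)]
  · -- members ≤ hi j
    rcases Nat.eq_zero_or_pos j with hj0 | hj0
    · subst hj0; rw [hS0, mem_insert, mem_singleton] at hk
      rcases hk with hk | hk <;> subst hk
      exacts [ha1' 1 (by omega), le_rfl]
    · rw [hSj j hj0, mem_singleton] at hk; subst hk; exact le_rfl
  · rw [hlo', if_neg (by omega)]
  · rw [hlo', if_neg (by omega)]; exact ha1' (j + 1) (by omega)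
  · -- nested: a (j+1) ≤ lo (j+1) = a (j+2)
    rw [hlo', if_neg (by omega)]; exact (hlt (j + 1) (by omega)).le
  · -- disjoint levels
    rcases Nat.eq_zero_or_pos i with hi0 | hi0
    · subst hi0
      rw [hS0, hSj j (by omega), disjoint_singleton_right, mem_insert, mem_singleton, not_or]
      have h1 := hsm 1 (j + 1) (by omega) (by omega)
      have h0 := hsm 0 (j + 1) (by omega) (by omega)
      rw [ha0] at h0
      exact ⟨by omega, by omega⟩
    · rw [hSj i hi0, hSj j (by omega), disjoint_singleton_left, mem_singleton]
      exact (hsm (i + 1) (j + 1) (by omega) (by omega)).ne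
  · -- the profile vanishes off the levels
    refine hLa l hl fun j hj hlj => ?_
    rcases Nat.lt_or_ge j 2 with hj2 | hj2
    · refine hnot 0 (by omega) ?_
      rw [hS0, mem_insert, mem_singleton]
      interval_cases j
      · left; rw [hlj, ha0]
      · right; exact hlj
    · refine hnot (j - 1) (by omega) ?_
      rw [hSj (j - 1) (by omega), mem_singleton, hlj]
      congr 1; omega
  · -- the youngest closure: (x_1 + x_(a_1))·(1 + κ_0) ≤ 0.8333·(1 + 143∕1000) ≤ 1
    rw [hsum0]
    have := hXPc q
    have := hXP0 q
    have := (hκ0b q).1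
    have := (hκ0b q).2
    nlinarith
  · rw [hsumj j q hj1]
    rcases Nat.lt_or_ge j 2 with hj2 | hj2
    · -- j = 1: the level {a_2} above the young pair: `row₃` at a′ = 58a_1, rescaled
      have hj : j = 1 := by omega
      subst hj
      have h2r : 2 < r := by omega
      have hκ0e : κ 0 q = 58 * (a 1 : ℝ) / (a 2 : ℝ) * J₅ (X 2 q) := by rw [hκ, if_pos rfl, if_pos h2r]
      have ha1n : (0 : ℝ) ≤ (a 1 : ℝ) := Nat.cast_nonneg _
      have ha2p : (0 : ℝ) < (a 2 : ℝ) := by exact_mod_cast ha1' 2 h2r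
      obtain ⟨h1, h2⟩ := row_5 hJ₅ hN (a := (a 1 : ℝ)) (a' := 58 * (a 1 : ℝ)) ha1n (by positivity) le_rfl (hX0 2 q) (hXc 2 q le_rfl h2r)
        (hκ0 1 q) (hA 1 q le_rfl h2r)
      show X 2 q * (1 + κ 1 q) < 1 ∧ (a 1 : ℝ) * (3 * X 2 q * (1 + κ 1 q) + κ 1 q) ≤ κ 0 q * (1 - X 2 q * (1 + κ 1 q)) * (lo 1 : ℝ)
      refine ⟨h1, ?_⟩
      have hlo1 : (lo 1 : ℝ) = (a 2 : ℝ) := by rw [hlo', if_neg one_ne_zero]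
      have e1 : κ 0 q * (1 - X 2 q * (1 + κ 1 q)) * (a 2 : ℝ) = J₅ (X 2 q) * (1 - X 2 q * (1 + κ 1 q)) * (58 * (a 1 : ℝ)) := by
        rw [hκ0e]; field_simp
      rw [hlo1, e1]; exact h2
    · -- j ≥ 2: tower levels {a_(j+1)} above {a_j}: `tower_closure`
      have hjm : j - 1 + 1 = j := by omega
      have hjm2 : j - 1 + 2 = j + 1 := by omega
      have h16 : 10 * a j ≤ a (j + 1) := haR j hj2 (by omega)
      have hlo_j : (lo j : ℝ) = (a (j + 1) : ℝ) := by rw [hlo', if_neg (by omega)]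
      rw [hlo_j, hjm]
      exact tower_closure hR1 hR2 hR3 hR4 hR5 h16 (hX0 (j + 1) q) (hXc (j + 1) q (by omega) (by omega)) (hκ0 j q) (hA j q (by omega) (by omega))
        (by rw [hκ, if_neg (by omega), if_pos (by omega), hjm, hjm2, hT])

/-! ## §3 The union: every young second age -/

/-- **THE CENSUS TOWER AT RATIO SIXTEEN FOR EVERY YOUNG SECOND AGE.**  Ages `a_0 = 1 < a_1 < a_2 < …` (`r ≥ 1`) with `2 ≤ a_1`, `58a_1 ≤ a_2`,
`10a_j ≤ a_{j+1}` (`j ≥ 2`), all `< K`, the profile vanishing off them: `0 ≤ ε ≤ e` at every pin — (E109d) for `a_1 ≥ 58`, §1 for `30 ≤ a_1 < 58`,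
§2 for `a_1 ≤ 29`. [folklore] -/
theorem flow_nonneg_census_tower10_every
    (hmono : ∀ u v : ℕ → ℝ, SeqBox γ u → SeqBox γ v → (∀ j, u j ≤ v j) → B u ≤ B v)
    (hL : ∀ k, 0 ≤ L k) (hb : 0 < b) (hlo : ∀ u, SeqBox γ u → b ≤ B u) (hdom : ∀ u, SeqBox γ u → ∑ k ∈ range K, L k * u k ≤ B u)
    (hh : SeqBox γ h) (hf : MemFlow B gIR h) (hg : ∀ t, 0 < g t ∧ g t ≤ 1)
    (hgF : ∀ t, 1 ≤ g t * (1 + ∑ k ∈ range K, L k * h (t + k) ^ 3 / 2))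
    {r : ℕ} {a : ℕ → ℕ} (hr : 1 ≤ r) (ha0 : a 0 = 1) (ha1 : 1 < r → 2 ≤ a 1) (ha2 : 2 < r → 58 * a 1 ≤ a 2)
    (haR : ∀ j, 2 ≤ j → j + 1 < r → 10 * a j ≤ a (j + 1)) (haK : ∀ j, j < r → a j < K)
    (hLa : ∀ l, l < K → (∀ j, j < r → l ≠ a j) → L l = 0)
    {N : ℕ} {KL : ℕ → ℕ → ℕ → ℝ}
    (hKL : ∀ k n l, KL k n l = if 0 < k ∧ k < K ∧ l < k then L k * h (n + k) ^ 3 / 2 * ∏ t ∈ Ico (n + 1 + l) (n + k + 1), g t else 0)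
    {KA : ℕ → ℕ → ℕ → ℝ} {RA : ℕ → (ℕ → ℝ) → ℕ → ℝ}
    (hRA : ∀ i v m, RA i v m = ∑ l ∈ range K, KA i m l * v (m + 1 + l))
    (hKA : ∀ i m l, KA i m l = KL i m l + KA (i + 1) m l) (hKAtop : ∀ m l, KA K m l = 0)
    {e ε : ℕ → ℝ} (he0 : ∀ m, 0 ≤ e m) (hea : ∀ m, e (m + 1) ≤ e m)
    (hεt : ∀ m, N < m → ε m = 0) (hεrec : ∀ m, ε m = e m - RA 1 ε m) : ∀ m, 0 ≤ ε m ∧ ε m ≤ e m := by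
  rcases Nat.lt_or_ge 1 r with h1r | h1r
  · rcases le_or_gt 58 (a 1) with h58 | h58
    · refine flow_nonneg_census_tower10 hmono hL hb hlo hdom hh hf hg hgF hr ha0 (fun _ => h58) (fun j hj hjr => ?_) haK hLa hKL hRA hKA hKAtop
        he0 hea hεt hεrec
      rcases Nat.lt_or_ge j 2 with hj2 | hj2
      · have hj : j = 1 := by omega
        subst hj; show 10 * a 1 ≤ a 2; have := ha2 hjr; omega
      · exact haR j hj2 hjr
    rcases le_or_gt 30 (a 1) with h30 | h30
    · exact flow_nonneg_census_tower10_mid hmono hL hb hlo hdom hh hf hg hgF hr ha0 (fun _ => h30) ha2 haR haK hLa hKL hRA hKA hKAtop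
        he0 hea hεt hεrec
    · exact flow_nonneg_census_tower10_young_pair hmono hL hb hlo hdom hh hf hg hgF h1r ha0 (ha1 h1r) (by omega) ha2 haR haK hLa hKL hRA hKA
        hKAtop he0 hea hεt hεrec
  · exact flow_nonneg_census_tower10_mid hmono hL hb hlo hdom hh hf hg hgF hr ha0 (fun h => absurd h (by omega)) (fun h => absurd h (by omega))
      haR haK hLa hKL hRA hKA hKAtop he0 hea hεt hεrec

end Summit.QuantumFields.BalabanUV.Beta.EriceRemainderEnclosureHistoryAutonomyComparisonAgeCompositionTower10Every
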